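import Literature.NumberTheory.LFunctions.SekatskiiLiZetaPartCriterion
import Literature.NumberTheory.LFunctions.KeiperLiTrend
import HarnessLib

/-!
# The archimedean part of Sekatskii's generalized Li derivatives: RH-FREE trend law, and exact compensation

LABEL (line 1): **RH-FREE** trend law for the whole `a`-family (the Gamma-factor / trivial-zero part
of `(1/(n−1)!) dⁿ/dzⁿ[(z+b)^{n−1} ln ξ(z)]|_{z=b+1}` is `(n/2)(H_n − 1 − ln(2π/(2b+1))) + O_b(1)`
unconditionally, with an explicit constant), and ONE **RH-CONDITIONAL** theorem: on RH the ζ-part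
`(1/(n−1)!) dⁿ/dzⁿ[(z+b)^{n−1} ln((z−1)ζ(z))]|_{z=b+1}` is `o(n)` for every `b > 0` — the statement
S. K. Sekatskii prints as a suspicion (arXiv:1404.7276v2, p. 19: "We suspect, but cannot prove, that
an exact compensation indeed occurs and … `= o(n)` for all `b > 0`"), PROVED here; with the
RH-EQUIVALENT packaging `RH ⟺ ζ-part = o(n)`.  bears_on: LADDER-RH L-P(P1) (COLUMN 4, LI: "RH-FREE
asymptotic of the archimedean part", here for the `a`-family) / L-C.  WHAT THIS IS NOT: the trend
law controls only the Gamma factor; the `o(n)` for the prime-power part is a CONSEQUENCE of RH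
(equivalent to it), not evidence for it; nothing here bears on the truth of RH.

Sources.  [Sekatskii2015FirstApplications] S. K. Sekatskii, arXiv:1404.7276v2 (2015), eq. (7a)
(p. 18), Lemma 2 / eq. (11) (p. 10), eq. (21) and the remark following it (p. 19); the `b = 0` shape
of the trend law is Voros 2006 §4 (4.6) / Bombieri–Lagarias 1999 Thm 2 (tree:
`KeiperLiTrend.lean`, `abs_keiperLiCoeff_sub_osc_sub_trend_le`), whose METHOD is followed here
verbatim with the affine change `z = −b + (2b+1)s`:

1. (`gammaPart_eq_re_iteratedDeriv`) `G_b(n) := liSekatskiiDeriv (−b)(b+1) n − liSekatskiiZetaDeriv (−b)(b+1) n`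
   (the archimedean part; by the sibling `sekatskii2015_eq7a` it is
   `S_b(n)/(2b+1) + (n/2)ψ((b+1)/2) + n/(b+1) − (n/2) ln π`) equals
   `(2b+1)⁻¹ Re 𝒜_b^{(n−1)}(0)/(n−1)!` for the generating function
   `𝒜_b(w) = (2b+1)·[1/ζ − ½ln π + ½ψ(ζ/2)]·L²`, `L = 1/(1−w)`, `ζ = −b + (2b+1)L` (Li's change of
   variables `iteratedDeriv_pow_mul_eq_iteratedDeriv_comp_liMap` after `z = −b + (2b+1)s`).
2. (`rem_eq`, `norm_rem_le`) Stirling `ψ(u) = Log u − 1/(2u) − 1/(12u²) + R₂(u)`,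
   `|R₂(u)| ≤ 1/(4π|u|² Re u)` (tree) splits `𝒜_b = E_b + B_b` with the elementary part
   `E_b = ((2b+1)/2) L² Log(L/2) + ((2b+1)/2)(ln(2b+1) − ln π) L² + ((1−b)/2) L` and `B_b` BOUNDED
   on the unit disc (`|B_b| ≤ M_b := b/2 + (2b+1)/6 + b²/4 + 2(2b+1)/π`; the three non-elementary
   pieces are `(β/2)(1−βε)⁻¹`, `((1−βε)⁻²)/(6(2b+1))`, `((2b+1)/2)·(Log(1−βε)+βε)/ε²`, `ε = 1−w`,
   `β = b/(2b+1) < ½`, all bounded because `Re(1−βε) > 1 − 2β = 1/(2b+1)`).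
3. (`abs_liSekatskiiDeriv_sub_zetaDeriv_sub_trend_le`) Taylor coefficients: `[w^m] L² Log(L/2) = (m+1)(H_{m+1} − 1 − ln 2)`, `[w^m]L² = m+1`,
   `[w^m]L = 1`, and Cauchy's estimate for `B_b`: for `b > 0`, `n ≥ 1`,
   `|G_b(n) − ((n/2)(H_n − 1 − ln(2π/(2b+1))) + (1−b)/(2(2b+1)))| ≤ M_b/(2b+1)`.
4. (`liSekatskiiDeriv_sub_zetaDeriv_isLittleO`, `sekatskii2015_lemma2_isLittleO`,
   `sekatskii2015_exactCompensation`, `riemannHypothesis_iff_zetaPart_isLittleO`)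
   `G_b(n) = ½ n ln n + ½(γ−1−ln(2π/(2b+1))) n + o(n)` = the main term of `k_{n,−b}/(2b+1)` on RH
   (tree `sekatskii2014b_thm4` = the source's Theorem 6), whence: RH-FREE, the exact linear term
   of the trivial-zero sum `S_b(n)` (the printed Lemma 2, eq. (11), only brackets it); on RH the
   ζ-part is `o(n)` (the source's open "exact compensation"), and conversely (`sekatskii2015_prop1`).

No named facts; private plumbing definitions `gen`, `elem`, `rem` only.

## References

* [Sekatskii2015FirstApplications] S. K. Sekatskii, arXiv:1404.7276v2 (2015), pp. 10, 18, 19.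
* [Voros2006] A. Voros, Math. Phys. Anal. Geom. 9 (2006) 53–63, §4 (4.6) (the `b = 0` trend).
* [AndrewsAskeyRoy1999] G. E. Andrews, R. Askey, R. Roy, *Special Functions* (1999), Cor. 1.4.5.
-/

noncomputable section

open Complex Filter Topology Set Metric Asymptotics
open scoped Nat

namespace Literature.NumberTheory.LFunctions

namespace Sekatskii2015Trend

/-! ### §0. Li's map on the unit disc (plumbing, as in `KeiperLiTrend.lean`) -/

/-- For `|z| < 1`, `z ≠ 1`. [folklore] -/
private theorem ne_one_of_norm_lt_one {z : ℂ} (hz : ‖z‖ < 1) : z ≠ 1 := fun h ↦ by simp [h] at hz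

/-- For `|z| < 1`, `Re (1/(1−z)) > 1/2`. [folklore] -/
private theorem one_half_lt_re_liMap {z : ℂ} (hz : ‖z‖ < 1) : 1 / 2 < (liMap z).re := by
  have hne : (1 - z) ≠ 0 := sub_ne_zero.2 (Ne.symm (ne_one_of_norm_lt_one hz))
  have hns : 0 < Complex.normSq (1 - z) := Complex.normSq_pos.2 hne
  rw [liMap, Complex.inv_re, lt_div_iff₀ hns]
  have h1 : Complex.normSq (1 - z) = (1 - z.re) ^ 2 + z.im ^ 2 := by
    rw [Complex.normSq_apply]; simp; ring
  have h2 : z.re ^ 2 + z.im ^ 2 < 1 := by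
    have h3 : Complex.normSq z < 1 := by
      rw [Complex.normSq_eq_norm_sq]; nlinarith [norm_nonneg z]
    rw [Complex.normSq_apply] at h3; nlinarith
  rw [h1]
  simp only [sub_re, one_re]
  nlinarith

/-- `m(z) ≠ 0`. [folklore] -/
private theorem liMap_ne_zero {z : ℂ} (hz : z ≠ 1) : liMap z ≠ 0 :=
  inv_ne_zero (sub_ne_zero.2 (Ne.symm hz))

/-- `m(z) · (1 − z) = 1`. [folklore] -/
private theorem liMap_mul_one_sub {z : ℂ} (hz : z ≠ 1) : liMap z * (1 - z) = 1 := by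
  rw [liMap, inv_mul_cancel₀ (sub_ne_zero.2 (Ne.symm hz))]

/-- On the unit disc `m(z)/2` lies in the right half-plane. [folklore] -/
private theorem re_liMap_half_pos {z : ℂ} (hz : ‖z‖ < 1) : 0 < (liMap z / 2).re := by
  have h := one_half_lt_re_liMap hz
  rw [Complex.div_ofNat_re]; linarith

/-- `dᵐ/dzᵐ [m(z)²](0) = (m+1)!`. [folklore] -/
private theorem iteratedDeriv_liMap_sq_zero (m : ℕ) :
    iteratedDeriv m (fun z ↦ liMap z ^ 2) 0 = ((m + 1)! : ℂ) := by
  have hev : (fun z ↦ liMap z ^ 2) =ᶠ[𝓝 (0 : ℂ)] deriv liMap := by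
    filter_upwards [eventually_ne_nhds (zero_ne_one : (0 : ℂ) ≠ 1)] with z hz
    exact (hasDerivAt_liMap hz).deriv.symm
  rw [hev.iteratedDeriv_eq, ← iteratedDeriv_succ', iteratedDeriv_liMap_zero]

/-- On the unit disc, `d/dz Log(m(z)/2) = m(z)`. [folklore] -/
private theorem hasDerivAt_log_liMap_half {z : ℂ} (hz : ‖z‖ < 1) :
    HasDerivAt (fun z ↦ Complex.log (liMap z / 2)) (liMap z) z := by
  have hz1 := ne_one_of_norm_lt_one hz
  have hsl : liMap z / 2 ∈ slitPlane := Complex.mem_slitPlane_iff.2 (Or.inl (re_liMap_half_pos hz))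
  have h1 : HasDerivAt (fun z ↦ liMap z / 2) (liMap z ^ 2 / 2) z :=
    (hasDerivAt_liMap hz1).div_const 2
  convert h1.clog hsl using 1
  have h0 := liMap_ne_zero hz1
  field_simp

/-- `Log(m(·)/2)` is analytic on the unit disc. [folklore] -/
private theorem analyticAt_log_liMap_half {z : ℂ} (hz : ‖z‖ < 1) :
    AnalyticAt ℂ (fun z ↦ Complex.log (liMap z / 2)) z := by
  have hz1 := ne_one_of_norm_lt_one hz
  exact ((analyticAt_liMap hz1).div analyticAt_const two_ne_zero).clog
    (Complex.mem_slitPlane_iff.2 (Or.inl (re_liMap_half_pos hz)))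

/-- `d^{i+1}/dz^{i+1} [Log(m(z)/2)](0) = i!`. [folklore] -/
private theorem iteratedDeriv_succ_log_liMap_half_zero (i : ℕ) :
    iteratedDeriv (i + 1) (fun z ↦ Complex.log (liMap z / 2)) 0 = (i ! : ℂ) := by
  rw [iteratedDeriv_succ']
  have hev : deriv (fun z ↦ Complex.log (liMap z / 2)) =ᶠ[𝓝 (0 : ℂ)] liMap := by
    filter_upwards [Metric.ball_mem_nhds (0 : ℂ) one_pos] with z hz
    exact (hasDerivAt_log_liMap_half (by simpa using hz)).deriv
  rw [hev.iteratedDeriv_eq, iteratedDeriv_liMap_zero]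

/-- Leibniz: `d^N/dz^N [(Log(m(z)/2) − 1) · m(z)](0) = N! (H_N − 1 − log 2)`. [folklore] -/
private theorem iteratedDeriv_log_liMap_half_mul_zero (N : ℕ) :
    iteratedDeriv N (fun z ↦ (-1 + Complex.log (liMap z / 2)) * liMap z) 0 =
      (N ! : ℂ) * ((∑ i ∈ Finset.range N, ((i : ℂ) + 1)⁻¹) - 1 - Real.log 2) := by
  have hF : ContDiffAt ℂ N (fun z ↦ -1 + Complex.log (liMap z / 2)) 0 :=
    (analyticAt_const.add (analyticAt_log_liMap_half (by simp))).contDiffAt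
  have hL : ContDiffAt ℂ N liMap 0 := (analyticAt_liMap zero_ne_one).contDiffAt
  rw [iteratedDeriv_fun_mul hF hL, Finset.sum_range_succ']
  have hlog : Complex.log (1 / 2) = -Real.log 2 := by
    rw [show (1 / 2 : ℂ) = ((1 / 2 : ℝ) : ℂ) by push_cast; ring, ← Complex.ofReal_log (by norm_num),
      show (1 / 2 : ℝ) = 2⁻¹ by norm_num, Real.log_inv]
    push_cast; ring
  have h0 : iteratedDeriv 0 (fun z ↦ -1 + Complex.log (liMap z / 2)) 0 = -1 - Real.log 2 := by
    rw [iteratedDeriv_zero, liMap_zero, hlog]; ring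
  have hS : ∀ i ∈ Finset.range N, (N.choose (i + 1) : ℂ) *
      iteratedDeriv (i + 1) (fun z ↦ -1 + Complex.log (liMap z / 2)) 0 *
      iteratedDeriv (N - (i + 1)) liMap 0 = (N ! : ℂ) * ((i : ℂ) + 1)⁻¹ := by
    intro i hi
    have hi' : i + 1 ≤ N := Finset.mem_range.1 hi
    rw [iteratedDeriv_const_add (Nat.succ_pos i), iteratedDeriv_liMap_zero,
      iteratedDeriv_succ_log_liMap_half_zero]
    have hc := congrArg (Nat.cast : ℕ → ℂ) (Nat.choose_mul_factorial_mul_factorial hi')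
    push_cast [Nat.factorial_succ] at hc
    have hi0 : ((i : ℂ) + 1) ≠ 0 := by exact_mod_cast Nat.succ_ne_zero i
    field_simp
    linear_combination hc
  rw [Finset.sum_congr rfl hS, h0, ← Finset.mul_sum, Nat.choose_zero_right, Nat.sub_zero,
    iteratedDeriv_liMap_zero]
  push_cast
  ring

/-- **Taylor coefficients of `m(z)² Log(m(z)/2)`**: `dᵐ/dzᵐ [m² Log(m/2)](0) = (m+1)! (H_{m+1} − 1 − log 2)`.
[folklore] -/
private theorem iteratedDeriv_liMap_sq_mul_log_zero (m : ℕ) :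
    iteratedDeriv m (fun z ↦ liMap z ^ 2 * Complex.log (liMap z / 2)) 0 =
      ((m + 1)! : ℂ) * ((∑ i ∈ Finset.range (m + 1), ((i : ℂ) + 1)⁻¹) - 1 - Real.log 2) := by
  have hev : (fun z ↦ liMap z ^ 2 * Complex.log (liMap z / 2)) =ᶠ[𝓝 (0 : ℂ)]
      deriv (fun z ↦ (-1 + Complex.log (liMap z / 2)) * liMap z) := by
    filter_upwards [Metric.ball_mem_nhds (0 : ℂ) one_pos] with z hz
    have hz' : ‖z‖ < 1 := by simpa using hz
    have h1 := hasDerivAt_log_liMap_half hz'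
    have h2 := hasDerivAt_liMap (ne_one_of_norm_lt_one hz')
    have h3 : HasDerivAt (fun z ↦ (-1 + Complex.log (liMap z / 2)) * liMap z)
        (liMap z * liMap z + (-1 + Complex.log (liMap z / 2)) * liMap z ^ 2) z :=
      (h1.const_add (-1)).mul h2
    rw [h3.deriv]
    ring
  rw [hev.iteratedDeriv_eq, ← iteratedDeriv_succ', iteratedDeriv_log_liMap_half_mul_zero]

/-- **Cauchy's estimate on the unit disc**: `‖Φ⁽ᵐ⁾(0)‖ ≤ m! · M` for `Φ` holomorphic and bounded by
`M` on `|z| < 1`. [folklore] -/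
private theorem norm_iteratedDeriv_le_of_forall_mem_unitBall {Φ : ℂ → ℂ} {M : ℝ}
    (hd : DifferentiableOn ℂ Φ (ball 0 1)) (hM : ∀ z ∈ ball (0 : ℂ) 1, ‖Φ z‖ ≤ M) (m : ℕ) :
    ‖iteratedDeriv m Φ 0‖ ≤ m ! * M := by
  have key : ∀ r : ℝ, 0 < r → r < 1 → ‖iteratedDeriv m Φ 0‖ ≤ m ! * M / r ^ m := by
    intro r hr0 hr1
    have hsub : closedBall (0 : ℂ) r ⊆ ball 0 1 := closedBall_subset_ball hr1
    have hdc : DiffContOnCl ℂ Φ (ball 0 r) :=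
      (hd.mono (closure_ball_subset_closedBall.trans hsub)).diffContOnCl
    exact Complex.norm_iteratedDeriv_le_of_forall_mem_sphere_norm_le m hr0 hdc
      fun z hz ↦ hM z (hsub (sphere_subset_closedBall hz))
  have hpow : Tendsto (fun r : ℝ ↦ r ^ m) (𝓝[<] (1 : ℝ)) (𝓝 1) := by
    have h := ((continuous_pow m).tendsto (1 : ℝ)).mono_left (nhdsWithin_le_nhds (s := Iio 1))
    simpa using h
  have hlim : Tendsto (fun r : ℝ ↦ (m ! : ℝ) * M / r ^ m) (𝓝[<] (1 : ℝ)) (𝓝 ((m ! : ℝ) * M)) := by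
    have h := (tendsto_const_nhds (x := (m ! : ℝ) * M)).div hpow one_ne_zero
    rw [div_one] at h
    exact h
  refine ge_of_tendsto hlim ?_
  filter_upwards [Ioo_mem_nhdsLT one_pos] with r hr
  exact key r hr.1 hr.2

/-- Iterated derivatives along an affine reparametrisation: for `F` analytic at `c + q s₀`,
`dⁿ/dsⁿ[F(c + q s)]|_{s=s₀} = qⁿ F⁽ⁿ⁾(c + q s₀)`. [folklore] -/
private theorem iteratedDeriv_comp_affine (c q : ℂ) :
    ∀ (n : ℕ) (F : ℂ → ℂ) (s₀ : ℂ), AnalyticAt ℂ F (c + q * s₀) →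
      iteratedDeriv n (fun s ↦ F (c + q * s)) s₀ = q ^ n * iteratedDeriv n F (c + q * s₀) := by
  intro n
  induction n with
  | zero => intro F s₀ _; simp
  | succ n ih =>
    intro F s₀ hF
    rw [iteratedDeriv_succ', iteratedDeriv_succ']
    have haff : ContinuousAt (fun s : ℂ ↦ c + q * s) s₀ := by fun_prop
    have hev : ∀ᶠ s in 𝓝 s₀, AnalyticAt ℂ F (c + q * s) := haff.eventually hF.eventually_analyticAt
    have hderiv : deriv (fun s ↦ F (c + q * s)) =ᶠ[𝓝 s₀] fun s ↦ q * deriv F (c + q * s) := by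
      filter_upwards [hev] with s hs
      have h1 : HasDerivAt (fun s : ℂ ↦ c + q * s) q s := by
        simpa using ((hasDerivAt_id s).const_mul q).const_add c
      have h2 : HasDerivAt (fun s ↦ F (c + q * s)) (deriv F (c + q * s) * q) s :=
        hs.differentiableAt.hasDerivAt.comp s h1
      rw [h2.deriv]
      ring
    rw [hderiv.iteratedDeriv_eq, iteratedDeriv_const_mul_field, ih (deriv F) s₀ hF.deriv, pow_succ]
    ring

/-! ### §1. The generating function of the archimedean part -/

/-- `ζ_w = −b + (2b+1) m(w)`, the affine image of Li's variable. [folklore] -/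
private def zetaW (b : ℝ) (w : ℂ) : ℂ := ((-b : ℝ) : ℂ) + (2 * (b : ℂ) + 1) * liMap w

/-- The generating function `𝒜_b(w) = (2b+1)·[1/ζ − ½ ln π + ½ψ(ζ/2)]·m(w)²`, `ζ = ζ_w`. [folklore] -/
private def gen (b : ℝ) (w : ℂ) : ℂ :=
  (2 * (b : ℂ) + 1) * ((zetaW b w)⁻¹ + (-(Real.log Real.pi : ℂ) / 2 + digamma (zetaW b w / 2) / 2)) *
    liMap w ^ 2

/-- The elementary part `E_b(w) = ((2b+1)/2) m² Log(m/2) + ((2b+1)/2)(ln(2b+1) − ln π) m² + ((1−b)/2) m`.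
[folklore] -/
private def elem (b : ℝ) (w : ℂ) : ℂ :=
  (2 * (b : ℂ) + 1) / 2 * (liMap w ^ 2 * Complex.log (liMap w / 2)) +
    (2 * (b : ℂ) + 1) / 2 * ((Real.log (2 * b + 1) : ℂ) - Real.log Real.pi) * liMap w ^ 2 +
    (1 - (b : ℂ)) / 2 * liMap w

/-- The remainder `B_b = 𝒜_b − E_b`. [folklore] -/
private def rem (b : ℝ) (w : ℂ) : ℂ := gen b w - elem b w

/-- The bound `M_b = b/2 + (2b+1)/6 + b²/4 + 2(2b+1)/π` for `|B_b|` on the unit disc. [folklore] -/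
private def remBound (b : ℝ) : ℝ := b / 2 + (2 * b + 1) / 6 + b ^ 2 / 4 + 2 * (2 * b + 1) / Real.pi

variable {b : ℝ}

/-- On the unit disc `Re ζ_w > 1/2`. [folklore] -/
private theorem re_zetaW_gt (hb : 0 ≤ b) {w : ℂ} (hw : ‖w‖ < 1) : 1 / 2 < (zetaW b w).re := by
  have h := one_half_lt_re_liMap hw
  have e : zetaW b w = ((-b : ℝ) : ℂ) + ((2 * b + 1 : ℝ) : ℂ) * liMap w := by
    rw [zetaW]; push_cast; ring
  rw [e, add_re, ofReal_re, re_ofReal_mul]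
  nlinarith

/-- `ζ_w ≠ 0` on the unit disc. [folklore] -/
private theorem zetaW_ne_zero (hb : 0 ≤ b) {w : ℂ} (hw : ‖w‖ < 1) : zetaW b w ≠ 0 := by
  intro h; have := re_zetaW_gt hb hw; rw [h] at this; simp at this; linarith

/-- `ζ_0 = b + 1`. [folklore] -/
private theorem zetaW_zero : zetaW b 0 = ((b + 1 : ℝ) : ℂ) := by
  rw [zetaW, liMap_zero]; push_cast; ring

/-- The factorisation `ζ_w = (2b+1)·m(w)·(1 − β(1−w))`, `β = b/(2b+1)`. [folklore] -/
private theorem zetaW_eq_prod (b : ℝ) (hb : 0 ≤ b) {w : ℂ} (hw1 : w ≠ 1) :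
    zetaW b w = ((2 * b + 1 : ℝ) : ℂ) * liMap w *
      (1 - ((b / (2 * b + 1) : ℝ) : ℂ) * (1 - w)) := by
  have hL := liMap_mul_one_sub hw1
  have hq : (2 * b + 1) ≠ 0 := by positivity
  have hqβ : ((2 * b + 1 : ℝ) : ℂ) * ((b / (2 * b + 1) : ℝ) : ℂ) = (b : ℂ) := by
    rw [← Complex.ofReal_mul]; congr 1; field_simp
  rw [zetaW, Complex.ofReal_neg, show (2 * (b : ℂ) + 1) = ((2 * b + 1 : ℝ) : ℂ) by push_cast; ring]
  linear_combination (liMap w * (1 - w)) * hqβ + (b : ℂ) * hL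

/-! ### §2. The archimedean part as a Taylor coefficient of `𝒜_b` -/

/-- `ζ₁(σ)` has positive real part at a real `σ > 1`. [folklore] -/
private theorem riemannZeta₁_ofReal_re_pos'' {σ : ℝ} (hσ : 1 < σ) : 0 < (riemannZeta₁ σ).re := by
  have h1 : (σ : ℂ) ≠ 1 := by
    intro h; have := congrArg Complex.re h; simp at this; linarith
  have hz := (Complex.pos_iff.mp (riemannZeta_pos_of_one_lt hσ)).1
  rw [riemannZeta₁_eq_mul h1, show (σ : ℂ) - 1 = ((σ - 1 : ℝ) : ℂ) by push_cast; ring,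
    Complex.re_ofReal_mul]
  exact mul_pos (by linarith) hz

/-- Near `p = b + 1` (`b > 0`), `H = log ξ − log ζ₁` has derivative `1/z − ½ log π + ½ψ(z/2)`
(`ξ′/ξ − ζ₁′/ζ₁`, tree: `logDeriv_riemannXi_eq_of_one_lt_re`, `logDeriv_riemannZeta₁_eq_of_one_lt_re`). [folklore] -/
private theorem eventually_hasDerivAt_archPart (hb : 0 < b) :
    ∀ᶠ z in 𝓝 ((b + 1 : ℝ) : ℂ), HasDerivAt
      (fun z ↦ Complex.log (riemannXi z) - Complex.log (riemannZeta₁ z))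
      (z⁻¹ + (-(Real.log Real.pi : ℂ) / 2 + digamma (z / 2) / 2)) z := by
  have hopen : IsOpen {z : ℂ | 1 < z.re} := isOpen_lt continuous_const Complex.continuous_re
  have hp : ((b + 1 : ℝ) : ℂ) ∈ {z : ℂ | 1 < z.re} := by simp; linarith
  have hslit₁ : riemannXi ((b + 1 : ℝ) : ℂ) ∈ slitPlane :=
    mem_slitPlane_iff.2 (Or.inl (Complex.pos_iff.1 (riemannXi_ofReal_pos (b + 1))).1)
  have hslit₂ : riemannZeta₁ ((b + 1 : ℝ) : ℂ) ∈ slitPlane :=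
    mem_slitPlane_iff.2 (Or.inl (riemannZeta₁_ofReal_re_pos'' (by linarith)))
  have hc₁ : ContinuousAt riemannXi ((b + 1 : ℝ) : ℂ) :=
    differentiable_riemannXi.continuous.continuousAt
  have hc₂ : ContinuousAt riemannZeta₁ ((b + 1 : ℝ) : ℂ) :=
    (differentiable_riemannZeta₁ _).continuousAt
  filter_upwards [hopen.mem_nhds hp, hc₁.eventually_mem (isOpen_slitPlane.mem_nhds hslit₁),
    hc₂.eventually_mem (isOpen_slitPlane.mem_nhds hslit₂)] with s hs hs₁ hs₂
  have h₁ := (differentiable_riemannXi s).hasDerivAt.clog hs₁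
  have h₂ := (differentiable_riemannZeta₁ s).hasDerivAt.clog hs₂
  refine (h₁.sub h₂).congr_deriv ?_
  rw [← logDeriv_apply, ← logDeriv_apply, logDeriv_riemannXi_eq_of_one_lt_re hs,
    logDeriv_riemannZeta₁_eq_of_one_lt_re hs]
  ring

/-- `H = log ξ − log ζ₁` is analytic at `p = b + 1`. [folklore] -/
private theorem analyticAt_archPart (hb : 0 < b) :
    AnalyticAt ℂ (fun z ↦ Complex.log (riemannXi z) - Complex.log (riemannZeta₁ z))
      ((b + 1 : ℝ) : ℂ) :=
  Complex.analyticAt_iff_eventually_differentiableAt.2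
    ((eventually_hasDerivAt_archPart hb).mono fun _ hz ↦ hz.differentiableAt)

/-- `𝒜_b` is the derivative of `w ↦ H(ζ_w)` near `w = 0`. [folklore] -/
private theorem eventually_deriv_eq_gen (hb : 0 < b) :
    deriv ((fun s ↦ Complex.log (riemannXi (((-b : ℝ) : ℂ) + (2 * (b : ℂ) + 1) * s)) -
        Complex.log (riemannZeta₁ (((-b : ℝ) : ℂ) + (2 * (b : ℂ) + 1) * s))) ∘ liMap) =ᶠ[𝓝 (0 : ℂ)]
      gen b := by
  have hH := eventually_hasDerivAt_archPart hb
  have hL : ContinuousAt liMap 0 := (analyticAt_liMap zero_ne_one).continuousAt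
  have hcont : ContinuousAt (zetaW b) 0 := by
    unfold zetaW; exact continuousAt_const.add (continuousAt_const.mul hL)
  rw [← zetaW_zero (b := b)] at hH
  filter_upwards [hcont.eventually hH, eventually_ne_nhds (zero_ne_one : (0 : ℂ) ≠ 1)] with w hw hw1
  have haff : HasDerivAt (fun s : ℂ ↦ ((-b : ℝ) : ℂ) + (2 * (b : ℂ) + 1) * s) (2 * (b : ℂ) + 1)
      (liMap w) := by
    simpa using ((hasDerivAt_id (liMap w)).const_mul (2 * (b : ℂ) + 1)).const_add (((-b : ℝ) : ℂ))
  have hw' : HasDerivAt (fun z ↦ Complex.log (riemannXi z) - Complex.log (riemannZeta₁ z))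
      ((zetaW b w)⁻¹ + (-(Real.log Real.pi : ℂ) / 2 + digamma (zetaW b w / 2) / 2))
      (((-b : ℝ) : ℂ) + (2 * (b : ℂ) + 1) * liMap w) := hw
  have hG₀ := hw'.comp (liMap w) haff
  have hG : HasDerivAt (fun s : ℂ ↦ Complex.log (riemannXi (((-b : ℝ) : ℂ) + (2 * (b : ℂ) + 1) * s)) -
      Complex.log (riemannZeta₁ (((-b : ℝ) : ℂ) + (2 * (b : ℂ) + 1) * s)))
      (((zetaW b w)⁻¹ + (-(Real.log Real.pi : ℂ) / 2 + digamma (zetaW b w / 2) / 2)) *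
        (2 * (b : ℂ) + 1)) (liMap w) := hG₀
  have hcomp := hG.comp w (hasDerivAt_liMap hw1)
  rw [hcomp.deriv, gen, zetaW]
  ring

/-- **The archimedean part as a Taylor coefficient** (Li's change of variables after
`z = −b + (2b+1)s`): for `b > 0` and `m ≥ 0`,
`liSekatskiiDeriv (−b)(b+1)(m+1) − liSekatskiiZetaDeriv (−b)(b+1)(m+1) = (2b+1)⁻¹ · Re 𝒜_b^{(m)}(0)/m!`.
[cite: Sekatskii2015FirstApplications, eq. (7a) (p. 18) (the Gamma-factor part)] -/
theorem gammaPart_eq_re_iteratedDeriv (hb : 0 < b) (m : ℕ) :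
    liSekatskiiDeriv (-b) (b + 1) (m + 1) - liSekatskiiZetaDeriv (-b) (b + 1) (m + 1) =
      (2 * b + 1)⁻¹ * (iteratedDeriv m (gen b) 0 / (m ! : ℂ)).re := by
  set a : ℂ := ((-b : ℝ) : ℂ) with ha
  set qc : ℂ := 2 * (b : ℂ) + 1 with hq
  have hq0 : qc ≠ 0 := by
    rw [hq, show (2 : ℂ) * b + 1 = ((2 * b + 1 : ℝ) : ℂ) by push_cast; ring]
    exact Complex.ofReal_ne_zero.2 (by linarith)
  have hp : ((b + 1 : ℝ) : ℂ) = a + qc * 1 := by rw [ha, hq]; push_cast; ring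
  -- the two derivatives as one
  have hXi : AnalyticAt ℂ (fun z ↦ Complex.log (riemannXi z)) ((b + 1 : ℝ) : ℂ) :=
    analyticAt_log_riemannXi_ofReal (b + 1)
  have hZ1 : AnalyticAt ℂ (fun z ↦ Complex.log (riemannZeta₁ z)) ((b + 1 : ℝ) : ℂ) :=
    ((differentiable_riemannZeta₁).analyticAt _).clog
      (mem_slitPlane_iff.2 (Or.inl (riemannZeta₁_ofReal_re_pos'' (by linarith))))
  have hP : AnalyticAt ℂ (fun z : ℂ ↦ (z - a) ^ m) ((b + 1 : ℝ) : ℂ) :=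
    (analyticAt_id.sub analyticAt_const).pow m
  have hsub : iteratedDeriv (m + 1) (fun z : ℂ ↦ (z - a) ^ m * Complex.log (riemannXi z))
        ((b + 1 : ℝ) : ℂ) -
      iteratedDeriv (m + 1) (fun z : ℂ ↦ (z - a) ^ m * Complex.log (riemannZeta₁ z))
        ((b + 1 : ℝ) : ℂ) =
      iteratedDeriv (m + 1) (fun z : ℂ ↦ (z - a) ^ m *
        (Complex.log (riemannXi z) - Complex.log (riemannZeta₁ z))) ((b + 1 : ℝ) : ℂ) := by
    have h1 : ContDiffAt ℂ (m + 1) (fun z : ℂ ↦ (z - a) ^ m * Complex.log (riemannXi z))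
        ((b + 1 : ℝ) : ℂ) := (hP.mul hXi).contDiffAt
    have h2 : ContDiffAt ℂ (m + 1) (fun z : ℂ ↦ (z - a) ^ m * Complex.log (riemannZeta₁ z))
        ((b + 1 : ℝ) : ℂ) := (hP.mul hZ1).contDiffAt
    rw [← iteratedDeriv_fun_sub h1 h2]
    congr 1; funext z; ring
  unfold liSekatskiiDeriv liSekatskiiZetaDeriv
  simp only [Nat.add_sub_cancel]
  rw [← Complex.sub_re, ← sub_div, hsub]
  -- affine change of variables `z = a + qc s`
  have hK : AnalyticAt ℂ (fun z : ℂ ↦ (z - a) ^ m *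
      (Complex.log (riemannXi z) - Complex.log (riemannZeta₁ z))) (a + qc * 1) := by
    rw [← hp]; exact hP.mul (analyticAt_archPart hb)
  have haff := iteratedDeriv_comp_affine a qc (m + 1)
    (fun z : ℂ ↦ (z - a) ^ m * (Complex.log (riemannXi z) - Complex.log (riemannZeta₁ z))) 1 hK
  have hfun : (fun s : ℂ ↦ (fun z : ℂ ↦ (z - a) ^ m *
      (Complex.log (riemannXi z) - Complex.log (riemannZeta₁ z))) (a + qc * s)) =
      fun s : ℂ ↦ qc ^ m * (s ^ m * (Complex.log (riemannXi (a + qc * s)) -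
        Complex.log (riemannZeta₁ (a + qc * s)))) := by
    funext s
    simp only [add_sub_cancel_left, mul_pow]
    ring
  rw [hfun, iteratedDeriv_const_mul_field] at haff
  -- Li's change of variables
  have hG1 : AnalyticAt ℂ (fun s : ℂ ↦ Complex.log (riemannXi (a + qc * s)) -
      Complex.log (riemannZeta₁ (a + qc * s))) 1 := by
    have h2 : AnalyticAt ℂ (fun s : ℂ ↦ a + qc * s) 1 :=
      analyticAt_const.add (analyticAt_const.mul analyticAt_id)
    have h1 := analyticAt_archPart hb
    rw [hp] at h1
    exact AnalyticAt.comp (f := fun s : ℂ ↦ a + qc * s) (x := (1 : ℂ)) h1 h2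
  have hli := iteratedDeriv_pow_mul_eq_iteratedDeriv_comp_liMap (m + 1) hG1
  simp only [Nat.add_sub_cancel] at hli
  rw [hli, iteratedDeriv_succ', (eventually_deriv_eq_gen hb).iteratedDeriv_eq] at haff
  -- `haff : qc^m * 𝒜^{(m)}(0) = qc^(m+1) * K^{(m+1)}(p)`
  rw [hp]
  have hK' : iteratedDeriv (m + 1) (fun z : ℂ ↦ (z - a) ^ m *
      (Complex.log (riemannXi z) - Complex.log (riemannZeta₁ z))) (a + qc * 1) =
      qc⁻¹ * iteratedDeriv m (gen b) 0 := by
    have hqm : qc ^ m ≠ 0 := pow_ne_zero _ hq0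
    rw [pow_succ] at haff
    field_simp at haff
    rw [eq_comm]
    field_simp
    linear_combination haff
  rw [hK', hq, show ((2 : ℂ) * b + 1)⁻¹ = (((2 * b + 1)⁻¹ : ℝ) : ℂ) by push_cast; ring, mul_div_assoc,
    Complex.re_ofReal_mul]

/-! ### §3. `𝒜_b = E_b + B_b` with `B_b` bounded on the unit disc -/

/-- On the unit disc, `Re(1 − β(1−w)) ≥ 1/(2b+1)` for `β = b/(2b+1)`, `b ≥ 0`. [folklore] -/
private theorem re_one_sub_beta_gt (hb : 0 ≤ b) {w : ℂ} (hw : ‖w‖ < 1) :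
    1 / (2 * b + 1) ≤ (1 - ((b / (2 * b + 1) : ℝ) : ℂ) * (1 - w)).re := by
  have hq : 0 < 2 * b + 1 := by linarith
  have hre : -‖w‖ ≤ w.re := by
    have := abs_re_le_norm w; rw [abs_le] at this; exact this.1
  rw [sub_re, one_re, re_ofReal_mul, sub_re, one_re]
  have hβ : 0 ≤ b / (2 * b + 1) := by positivity
  have hβ2 : b / (2 * b + 1) * 2 = 1 - 1 / (2 * b + 1) := by field_simp; ring
  have h2 : 1 - w.re ≤ 2 := by linarith
  nlinarith [mul_le_mul_of_nonneg_left h2 hβ]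

/-- On the unit disc, `1 − β(1−w) ≠ 0` and `‖(1 − β(1−w))⁻¹‖ ≤ 2b+1`. [folklore] -/
private theorem norm_inv_one_sub_beta_le (hb : 0 ≤ b) {w : ℂ} (hw : ‖w‖ < 1) :
    (1 - ((b / (2 * b + 1) : ℝ) : ℂ) * (1 - w)) ≠ 0 ∧
      ‖(1 - ((b / (2 * b + 1) : ℝ) : ℂ) * (1 - w))⁻¹‖ ≤ 2 * b + 1 := by
  have hq : 0 < 2 * b + 1 := by linarith
  have hre := re_one_sub_beta_gt hb hw
  have hpos : 0 < (1 - ((b / (2 * b + 1) : ℝ) : ℂ) * (1 - w)).re :=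
    lt_of_lt_of_le (by positivity) hre
  have hne : (1 - ((b / (2 * b + 1) : ℝ) : ℂ) * (1 - w)) ≠ 0 := by
    intro h; rw [h] at hpos; simp at hpos
  refine ⟨hne, ?_⟩
  have hnorm : 1 / (2 * b + 1) ≤ ‖1 - ((b / (2 * b + 1) : ℝ) : ℂ) * (1 - w)‖ :=
    hre.trans (Complex.re_le_norm _)
  rw [norm_inv, inv_le_comm₀ (norm_pos_iff.2 hne) hq]
  rw [one_div] at hnorm
  exact hnorm

/-- On the unit disc, `‖(Log(1 − β(1−w)) + β(1−w))·m(w)²‖ ≤ β²(2b+1)/2`. [folklore] -/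
private theorem norm_sigma_le (hb : 0 ≤ b) {w : ℂ} (hw : ‖w‖ < 1) :
    ‖(Complex.log (1 - ((b / (2 * b + 1) : ℝ) : ℂ) * (1 - w)) +
        ((b / (2 * b + 1) : ℝ) : ℂ) * (1 - w)) * liMap w ^ 2‖ ≤
      (b / (2 * b + 1)) ^ 2 * (2 * b + 1) / 2 := by
  set β : ℝ := b / (2 * b + 1) with hβdef
  have hq : 0 < 2 * b + 1 := by linarith
  have hβ0 : 0 ≤ β := by rw [hβdef]; positivity
  have hβhalf : 2 * β = 1 - 1 / (2 * b + 1) := by rw [hβdef]; field_simp; ring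
  have hq1 : 0 < 1 / (2 * b + 1) := by positivity
  have hw1 : w ≠ 1 := ne_one_of_norm_lt_one hw
  -- `t = −β(1−w)`, `‖t‖ < 2β < 1`
  set t : ℂ := -(((β : ℝ) : ℂ) * (1 - w)) with ht
  have h1w : ‖1 - w‖ ≤ 1 + ‖w‖ := by
    calc ‖1 - w‖ ≤ ‖(1 : ℂ)‖ + ‖w‖ := norm_sub_le _ _
      _ = 1 + ‖w‖ := by simp
  have htn : ‖t‖ = β * ‖1 - w‖ := by
    rw [ht, norm_neg, norm_mul, Complex.norm_real, Real.norm_of_nonneg hβ0]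
  have htlt : ‖t‖ < 2 * β ∨ β = 0 := by
    rcases eq_or_lt_of_le hβ0 with h | h
    · exact Or.inr h.symm
    · left; rw [htn]; nlinarith
  have ht1 : ‖t‖ < 1 := by
    rcases htlt with h | h
    · linarith
    · rw [htn, h, zero_mul]; exact zero_lt_one
  have hlog := Complex.norm_log_one_add_sub_self_le ht1
  have heq : Complex.log (1 - ((β : ℝ) : ℂ) * (1 - w)) + ((β : ℝ) : ℂ) * (1 - w) =
      Complex.log (1 + t) - t := by rw [ht]; ring_nf
  rw [norm_mul, heq, norm_pow]
  -- `‖log(1+t) − t‖ ≤ ‖t‖²(1−‖t‖)⁻¹/2 ≤ β²‖1−w‖²(2b+1)/2`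
  have hinv : (1 - ‖t‖)⁻¹ ≤ 2 * b + 1 := by
    have h1 : 1 / (2 * b + 1) ≤ 1 - ‖t‖ := by
      rcases htlt with h | h
      · linarith
      · rw [htn, h, zero_mul]; have : 1 / (2 * b + 1) ≤ 1 := by
          rw [div_le_one hq]; linarith
        linarith
    calc (1 - ‖t‖)⁻¹ ≤ (1 / (2 * b + 1))⁻¹ := inv_anti₀ hq1 h1
      _ = 2 * b + 1 := by rw [one_div, inv_inv]
  have hL : ‖liMap w‖ * ‖1 - w‖ = 1 := by
    rw [← norm_mul, liMap_mul_one_sub hw1, norm_one]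
  have ht2 : ‖t‖ ^ 2 * ‖liMap w‖ ^ 2 = β ^ 2 := by
    rw [htn, show (β * ‖1 - w‖) ^ 2 * ‖liMap w‖ ^ 2 = β ^ 2 * (‖liMap w‖ * ‖1 - w‖) ^ 2 by ring,
      hL]; ring
  calc ‖Complex.log (1 + t) - t‖ * ‖liMap w‖ ^ 2
      ≤ ‖t‖ ^ 2 * (1 - ‖t‖)⁻¹ / 2 * ‖liMap w‖ ^ 2 :=
        mul_le_mul_of_nonneg_right hlog (sq_nonneg _)
    _ ≤ ‖t‖ ^ 2 * (2 * b + 1) / 2 * ‖liMap w‖ ^ 2 := by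
        gcongr
    _ = β ^ 2 * (2 * b + 1) / 2 := by
        rw [show ‖t‖ ^ 2 * (2 * b + 1) / 2 * ‖liMap w‖ ^ 2 =
          (‖t‖ ^ 2 * ‖liMap w‖ ^ 2) * (2 * b + 1) / 2 by ring, ht2]

/-- On the unit disc, the Stirling remainder term is bounded:
`‖((2b+1) m²/2)·R₂(ζ/2)‖ ≤ 2(2b+1)/π`, `R₂(u) = ψ(u) − Log u + 1/(2u) + 1/(12u²)`. [folklore] -/
private theorem norm_stirlingPiece_le (hb : 0 ≤ b) {w : ℂ} (hw : ‖w‖ < 1) :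
    ‖(2 * (b : ℂ) + 1) * liMap w ^ 2 / 2 * (digamma (zetaW b w / 2) - Complex.log (zetaW b w / 2) +
        1 / (2 * (zetaW b w / 2)) + 1 / (12 * (zetaW b w / 2) ^ 2))‖ ≤ 2 * (2 * b + 1) / Real.pi := by
  have hq : 0 < 2 * b + 1 := by linarith
  have hw1 : w ≠ 1 := ne_one_of_norm_lt_one hw
  have hζre := re_zetaW_gt hb hw
  have hu : 0 < (zetaW b w / 2).re := by rw [Complex.div_ofNat_re]; linarith
  have hR := norm_digamma_sub_stirling_two_le hu
  -- `‖ζ‖ ≥ ‖L‖`: `ζ = (2b+1) L (1 − β(1−w))`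
  obtain ⟨hne, hρ⟩ := norm_inv_one_sub_beta_le hb hw
  have hζ := zetaW_eq_prod b hb hw1
  have hLpos : 0 < ‖liMap w‖ := norm_pos_iff.2 (liMap_ne_zero hw1)
  have hζnorm : ‖liMap w‖ ≤ ‖zetaW b w‖ := by
    rw [hζ, norm_mul, norm_mul, Complex.norm_real, Real.norm_of_nonneg hq.le]
    have h1 : 1 / (2 * b + 1) ≤ ‖1 - ((b / (2 * b + 1) : ℝ) : ℂ) * (1 - w)‖ :=
      (re_one_sub_beta_gt hb hw).trans (Complex.re_le_norm _)
    calc ‖liMap w‖ = (2 * b + 1) * ‖liMap w‖ * (1 / (2 * b + 1)) := by field_simp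
      _ ≤ (2 * b + 1) * ‖liMap w‖ * ‖1 - ((b / (2 * b + 1) : ℝ) : ℂ) * (1 - w)‖ :=
          mul_le_mul_of_nonneg_left h1 (by positivity)
  have hu_norm : ‖liMap w‖ / 2 ≤ ‖zetaW b w / 2‖ := by
    rw [norm_div, RCLike.norm_ofNat]; linarith
  have hu_re : 1 / 4 < (zetaW b w / 2).re := by rw [Complex.div_ofNat_re]; linarith
  -- bound the Stirling remainder by `4/(π ‖L‖²)`
  have hden : ‖liMap w‖ ^ 2 / 16 ≤ ‖zetaW b w / 2‖ ^ 2 * (zetaW b w / 2).re := by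
    have h1 : ‖liMap w‖ ^ 2 / 4 ≤ ‖zetaW b w / 2‖ ^ 2 := by
      calc ‖liMap w‖ ^ 2 / 4 = (‖liMap w‖ / 2) ^ 2 := by ring
        _ ≤ ‖zetaW b w / 2‖ ^ 2 := pow_le_pow_left₀ (by positivity) hu_norm 2
    nlinarith [sq_nonneg ‖zetaW b w / 2‖]
  have hRle : 1 / (4 * Real.pi) / (‖zetaW b w / 2‖ ^ 2 * (zetaW b w / 2).re) ≤
      4 / (Real.pi * ‖liMap w‖ ^ 2) := by
    have hπ := Real.pi_pos
    have hd0 : 0 < ‖liMap w‖ ^ 2 / 16 := by positivity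
    calc 1 / (4 * Real.pi) / (‖zetaW b w / 2‖ ^ 2 * (zetaW b w / 2).re)
        ≤ 1 / (4 * Real.pi) / (‖liMap w‖ ^ 2 / 16) :=
          div_le_div_of_nonneg_left (by positivity) hd0 hden
      _ = 4 / (Real.pi * ‖liMap w‖ ^ 2) := by field_simp; ring
  rw [norm_mul]
  calc ‖(2 * (b : ℂ) + 1) * liMap w ^ 2 / 2‖ * ‖digamma (zetaW b w / 2) - Complex.log (zetaW b w / 2) +
        1 / (2 * (zetaW b w / 2)) + 1 / (12 * (zetaW b w / 2) ^ 2)‖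
      ≤ ‖(2 * (b : ℂ) + 1) * liMap w ^ 2 / 2‖ * (4 / (Real.pi * ‖liMap w‖ ^ 2)) :=
        mul_le_mul_of_nonneg_left (hR.trans hRle) (norm_nonneg _)
    _ = 2 * (2 * b + 1) / Real.pi := by
        rw [norm_div, norm_mul, norm_pow, RCLike.norm_ofNat,
          show (2 * (b : ℂ) + 1) = ((2 * b + 1 : ℝ) : ℂ) by push_cast; ring, Complex.norm_real,
          Real.norm_of_nonneg hq.le]
        have hπ : Real.pi ≠ 0 := Real.pi_ne_zero
        field_simp
        ring

/-- The product formula for the principal logarithm of `ζ_w/2` on the unit disc: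
`Log(ζ_w/2) = ln(2b+1) + Log(m(w)/2) + Log(1 − β(1−w))` (all three factors in the right half-plane).
[folklore] -/
private theorem log_zetaW_half (hb : 0 ≤ b) {w : ℂ} (hw : ‖w‖ < 1) :
    Complex.log (zetaW b w / 2) = (Real.log (2 * b + 1) : ℂ) + Complex.log (liMap w / 2) +
      Complex.log (1 - ((b / (2 * b + 1) : ℝ) : ℂ) * (1 - w)) := by
  have hq : 0 < 2 * b + 1 := by linarith
  have hw1 : w ≠ 1 := ne_one_of_norm_lt_one hw
  obtain ⟨hne, -⟩ := norm_inv_one_sub_beta_le hb hw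
  have hL2 : liMap w / 2 ≠ 0 := div_ne_zero (liMap_ne_zero hw1) two_ne_zero
  have hζ : zetaW b w / 2 = ((2 * b + 1 : ℝ) : ℂ) * (liMap w / 2 *
      (1 - ((b / (2 * b + 1) : ℝ) : ℂ) * (1 - w))) := by
    rw [zetaW_eq_prod b hb hw1]; ring
  rw [hζ, Complex.log_ofReal_mul hq (mul_ne_zero hL2 hne), add_assoc, Complex.log_mul hL2 hne]
  -- the arguments: both factors have positive real part
  have h1 : |(liMap w / 2).arg| < Real.pi / 2 :=
    Complex.abs_arg_lt_pi_div_two_iff.2 (Or.inl (re_liMap_half_pos hw))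
  have h2 : |(1 - ((b / (2 * b + 1) : ℝ) : ℂ) * (1 - w)).arg| < Real.pi / 2 :=
    Complex.abs_arg_lt_pi_div_two_iff.2
      (Or.inl (lt_of_lt_of_le (by positivity) (re_one_sub_beta_gt hb hw)))
  rw [abs_lt] at h1 h2
  constructor <;> linarith

/-- **The remainder in closed form on the unit disc**: with `β = b/(2b+1)`, `ε = 1 − w`, `L = m(w)`,
`ζ = ζ_w`, `q = 2b+1`,
`B_b(w) = (β/2)(1−βε)⁻¹ − (1−βε)⁻²/(6q) + (q/2)(Log(1−βε)+βε)L² + (qL²/2)·R₂(ζ/2)`. [folklore] -/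
private theorem rem_eq (hb : 0 ≤ b) {w : ℂ} (hw : ‖w‖ < 1) :
    rem b w = ((b / (2 * b + 1) : ℝ) : ℂ) / 2 * (1 - ((b / (2 * b + 1) : ℝ) : ℂ) * (1 - w))⁻¹ -
      ((1 - ((b / (2 * b + 1) : ℝ) : ℂ) * (1 - w))⁻¹) ^ 2 / (6 * (2 * (b : ℂ) + 1)) +
      (2 * (b : ℂ) + 1) / 2 * ((Complex.log (1 - ((b / (2 * b + 1) : ℝ) : ℂ) * (1 - w)) +
        ((b / (2 * b + 1) : ℝ) : ℂ) * (1 - w)) * liMap w ^ 2) +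
      (2 * (b : ℂ) + 1) * liMap w ^ 2 / 2 * (digamma (zetaW b w / 2) - Complex.log (zetaW b w / 2) +
        1 / (2 * (zetaW b w / 2)) + 1 / (12 * (zetaW b w / 2) ^ 2)) := by
  have hq : 0 < 2 * b + 1 := by linarith
  have hw1 : w ≠ 1 := ne_one_of_norm_lt_one hw
  obtain ⟨hne, -⟩ := norm_inv_one_sub_beta_le hb hw
  have hlog := log_zetaW_half hb hw
  have h1w : (1 - w) ≠ 0 := sub_ne_zero.2 (Ne.symm hw1)
  have hq' : (2 * (b : ℂ) + 1) ≠ 0 := by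
    rw [show (2 : ℂ) * b + 1 = ((2 * b + 1 : ℝ) : ℂ) by push_cast; ring]
    exact Complex.ofReal_ne_zero.2 hq.ne'
  have hqβ : (2 * (b : ℂ) + 1) * ((b / (2 * b + 1) : ℝ) : ℂ) = (b : ℂ) := by
    rw [show (2 * (b : ℂ) + 1) = ((2 * b + 1 : ℝ) : ℂ) by push_cast; ring, ← Complex.ofReal_mul]
    congr 1; field_simp
  -- express everything through `ε = 1 − w`, `β` and `q`
  have hζ : zetaW b w = (2 * (b : ℂ) + 1) * (1 - w)⁻¹ *
      (1 - ((b / (2 * b + 1) : ℝ) : ℂ) * (1 - w)) := by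
    rw [zetaW_eq_prod b hb hw1, liMap, show ((2 * b + 1 : ℝ) : ℂ) = 2 * (b : ℂ) + 1 by
      push_cast; ring]
  rw [rem, gen, elem, hlog]
  -- keep `digamma (ζ/2)` as an atom, substitute `ζ` elsewhere
  set D := digamma (zetaW b w / 2) with hD
  rw [hζ, liMap]
  generalize hQ : (2 * (b : ℂ) + 1) = Q at hq' hqβ ⊢
  generalize hR : (1 - ((b / (2 * b + 1) : ℝ) : ℂ) * (1 - w)) = R at hne ⊢
  generalize hB : ((b / (2 * b + 1) : ℝ) : ℂ) = B at hqβ hR ⊢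
  rw [← hqβ]
  field_simp
  rw [← hR]
  ring

/-- **`B_b` is bounded on the unit disc**: `‖B_b(w)‖ ≤ M_b`. [folklore] -/
private theorem norm_rem_le (hb : 0 ≤ b) {w : ℂ} (hw : ‖w‖ < 1) : ‖rem b w‖ ≤ remBound b := by
  have hq : 0 < 2 * b + 1 := by linarith
  obtain ⟨hne, hρ⟩ := norm_inv_one_sub_beta_le hb hw
  have hσ := norm_sigma_le hb hw
  have hS := norm_stirlingPiece_le hb hw
  rw [rem_eq hb hw, remBound]
  set ρ := (1 - ((b / (2 * b + 1) : ℝ) : ℂ) * (1 - w))⁻¹ with hρdef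
  have hβ0 : 0 ≤ b / (2 * b + 1) := by positivity
  have hβq : b / (2 * b + 1) * (2 * b + 1) = b := by field_simp
  -- piece 1
  have h1 : ‖((b / (2 * b + 1) : ℝ) : ℂ) / 2 * ρ‖ ≤ b / 2 := by
    rw [norm_mul, norm_div, Complex.norm_real, Real.norm_of_nonneg hβ0, RCLike.norm_ofNat]
    calc b / (2 * b + 1) / 2 * ‖ρ‖ ≤ b / (2 * b + 1) / 2 * (2 * b + 1) :=
          mul_le_mul_of_nonneg_left hρ (by positivity)
      _ = b / 2 := by field_simp
  -- piece 2
  have h2 : ‖ρ ^ 2 / (6 * (2 * (b : ℂ) + 1))‖ ≤ (2 * b + 1) / 6 := by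
    rw [norm_div, norm_pow, norm_mul, RCLike.norm_ofNat,
      show (2 * (b : ℂ) + 1) = ((2 * b + 1 : ℝ) : ℂ) by push_cast; ring, Complex.norm_real,
      Real.norm_of_nonneg hq.le]
    have : ‖ρ‖ ^ 2 ≤ (2 * b + 1) ^ 2 := pow_le_pow_left₀ (norm_nonneg _) hρ 2
    rw [div_le_div_iff₀ (by positivity) (by norm_num)]
    nlinarith
  -- piece 3
  have h3 : ‖(2 * (b : ℂ) + 1) / 2 * ((Complex.log (1 - ((b / (2 * b + 1) : ℝ) : ℂ) * (1 - w)) +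
      ((b / (2 * b + 1) : ℝ) : ℂ) * (1 - w)) * liMap w ^ 2)‖ ≤ b ^ 2 / 4 := by
    rw [norm_mul, norm_div, RCLike.norm_ofNat,
      show (2 * (b : ℂ) + 1) = ((2 * b + 1 : ℝ) : ℂ) by push_cast; ring, Complex.norm_real,
      Real.norm_of_nonneg hq.le]
    calc (2 * b + 1) / 2 * ‖(Complex.log (1 - ((b / (2 * b + 1) : ℝ) : ℂ) * (1 - w)) +
          ((b / (2 * b + 1) : ℝ) : ℂ) * (1 - w)) * liMap w ^ 2‖
        ≤ (2 * b + 1) / 2 * ((b / (2 * b + 1)) ^ 2 * (2 * b + 1) / 2) :=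
          mul_le_mul_of_nonneg_left hσ (by positivity)
      _ = b ^ 2 / 4 := by field_simp; ring
  have := norm_add_le_of_le (norm_add_le_of_le (norm_sub_le_of_le h1 h2) h3) hS
  linarith [this]

/-! ### §4. Holomorphy on the disc; Cauchy's estimate for `B_b`; Taylor coefficients of `E_b` -/

/-- `𝒜_b` is holomorphic on the unit disc. [folklore] -/
private theorem differentiableOn_gen (hb : 0 ≤ b) : DifferentiableOn ℂ (gen b) (ball 0 1) := by
  intro w hw
  have hw' : ‖w‖ < 1 := by simpa using hw
  have hw1 := ne_one_of_norm_lt_one hw'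
  have hL : DifferentiableAt ℂ liMap w := (hasDerivAt_liMap hw1).differentiableAt
  have hζd : DifferentiableAt ℂ (zetaW b) w := by
    unfold zetaW; exact (hL.const_mul _).const_add _
  have hζ0 := zetaW_ne_zero hb hw'
  have hu : 0 < (zetaW b w / 2).re := by
    rw [Complex.div_ofNat_re]; linarith [re_zetaW_gt hb hw']
  have hψ : DifferentiableAt ℂ digamma (zetaW b w / 2) :=
    (Literature.Analysis.SpecialFunctions.Complex.differentiableOn_digamma _ hu).differentiableAt
      ((isOpen_lt continuous_const Complex.continuous_re).mem_nhds hu)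
  have hψ' : DifferentiableAt ℂ (fun w ↦ digamma (zetaW b w / 2)) w := hψ.comp w (hζd.div_const 2)
  unfold gen
  exact (((differentiableAt_const _).mul ((hζd.inv hζ0).add ((differentiableAt_const _).add
    (hψ'.div_const 2)))).mul (hL.pow 2)).differentiableWithinAt

/-- `E_b` is analytic on the unit disc. [folklore] -/
private theorem analyticAt_elem {w : ℂ} (hw : ‖w‖ < 1) : AnalyticAt ℂ (elem b) w := by
  have hw1 := ne_one_of_norm_lt_one hw
  have hA : AnalyticAt ℂ liMap w := analyticAt_liMap hw1
  have hlog := analyticAt_log_liMap_half hw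
  unfold elem
  exact ((analyticAt_const.mul ((hA.pow 2).mul hlog)).add (analyticAt_const.mul (hA.pow 2))).add
    (analyticAt_const.mul hA)

/-- `B_b` is holomorphic on the unit disc. [folklore] -/
private theorem differentiableOn_rem (hb : 0 ≤ b) : DifferentiableOn ℂ (rem b) (ball 0 1) := by
  intro w hw
  have hw' : ‖w‖ < 1 := by simpa using hw
  unfold rem
  exact ((differentiableOn_gen hb w hw).differentiableAt (isOpen_ball.mem_nhds hw)).sub
    (analyticAt_elem hw').differentiableAt |>.differentiableWithinAt

/-- **Cauchy bound for the remainder coefficients**: `‖B_b⁽ᵐ⁾(0)‖ ≤ m! · M_b`. [folklore] -/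
private theorem norm_iteratedDeriv_rem_le (hb : 0 ≤ b) (m : ℕ) :
    ‖iteratedDeriv m (rem b) 0‖ ≤ m ! * remBound b :=
  norm_iteratedDeriv_le_of_forall_mem_unitBall (differentiableOn_rem hb)
    (fun w hw ↦ norm_rem_le hb (by simpa using hw)) m

/-- **Taylor coefficients of the elementary part**:
`E_b⁽ᵐ⁾(0) = ((2b+1)/2)(m+1)!(H_{m+1} − 1 − ln 2) + ((2b+1)/2)(ln(2b+1) − ln π)(m+1)! + ((1−b)/2) m!`.
[folklore] -/
private theorem iteratedDeriv_elem_zero (m : ℕ) :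
    iteratedDeriv m (elem b) 0 =
      (2 * (b : ℂ) + 1) / 2 * (((m + 1)! : ℂ) * ((∑ i ∈ Finset.range (m + 1), ((i : ℂ) + 1)⁻¹) -
        1 - Real.log 2)) +
      (2 * (b : ℂ) + 1) / 2 * ((Real.log (2 * b + 1) : ℂ) - Real.log Real.pi) * ((m + 1)! : ℂ) +
      (1 - (b : ℂ)) / 2 * (m ! : ℂ) := by
  have h0 : ‖(0 : ℂ)‖ < 1 := by simp
  have hA : AnalyticAt ℂ liMap 0 := analyticAt_liMap zero_ne_one
  have hlog := analyticAt_log_liMap_half h0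
  have h1 : ContDiffAt ℂ m (fun w ↦ (2 * (b : ℂ) + 1) / 2 * (liMap w ^ 2 * Complex.log (liMap w / 2))) 0 :=
    (analyticAt_const.mul ((hA.pow 2).mul hlog)).contDiffAt
  have h2 : ContDiffAt ℂ m (fun w ↦ (2 * (b : ℂ) + 1) / 2 * ((Real.log (2 * b + 1) : ℂ) -
      Real.log Real.pi) * liMap w ^ 2) 0 := (analyticAt_const.mul (hA.pow 2)).contDiffAt
  have h3 : ContDiffAt ℂ m (fun w ↦ (1 - (b : ℂ)) / 2 * liMap w) 0 := (analyticAt_const.mul hA).contDiffAt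
  have hfun : elem b = fun w ↦ (2 * (b : ℂ) + 1) / 2 * (liMap w ^ 2 * Complex.log (liMap w / 2)) +
      (2 * (b : ℂ) + 1) / 2 * ((Real.log (2 * b + 1) : ℂ) - Real.log Real.pi) * liMap w ^ 2 +
      (1 - (b : ℂ)) / 2 * liMap w := by funext w; rfl
  rw [hfun, iteratedDeriv_fun_add (h1.add h2) h3, iteratedDeriv_fun_add h1 h2,
    iteratedDeriv_const_mul_field, iteratedDeriv_liMap_sq_mul_log_zero,
    iteratedDeriv_const_mul_field, iteratedDeriv_liMap_sq_zero,
    iteratedDeriv_const_mul_field, iteratedDeriv_liMap_zero]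

/-- The harmonic number as a complex sum: `H_n = Σ_{i<n} 1/(i+1)`. [folklore] -/
private theorem harmonic_cast_eq_sum (n : ℕ) :
    (((harmonic n : ℚ) : ℝ) : ℂ) = ∑ i ∈ Finset.range n, ((i : ℂ) + 1)⁻¹ := by
  simp [harmonic]

/-- `𝒜_b⁽ᵐ⁾(0) = E_b⁽ᵐ⁾(0) + B_b⁽ᵐ⁾(0)`. [folklore] -/
private theorem iteratedDeriv_gen_zero (hb : 0 < b) (m : ℕ) :
    iteratedDeriv m (gen b) 0 = iteratedDeriv m (elem b) 0 + iteratedDeriv m (rem b) 0 := by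
  have hfun : gen b = fun w ↦ elem b w + rem b w := by
    funext w; simp only [rem]; ring
  have h0 : ‖(0 : ℂ)‖ < 1 := by simp
  have hE : ContDiffAt ℂ m (elem b) 0 := (analyticAt_elem h0).contDiffAt
  have hR : ContDiffAt ℂ m (rem b) 0 :=
    ((differentiableOn_rem hb.le).analyticAt (ball_mem_nhds (0 : ℂ) one_pos)).contDiffAt
  rw [hfun, iteratedDeriv_fun_add hE hR]

/-- `1 = o(n)` along `ℕ → ∞`. [folklore] -/
private theorem isLittleO_one_natCast :
    (fun _ : ℕ ↦ (1 : ℝ)) =o[atTop] (fun n : ℕ ↦ (n : ℝ)) := by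
  refine Asymptotics.isLittleO_iff.2 fun c hc ↦ ?_
  obtain ⟨N, hN⟩ := exists_nat_ge (1 / c)
  filter_upwards [eventually_ge_atTop N] with n hn
  rw [norm_one, Real.norm_natCast]
  have hNn : (N : ℝ) ≤ n := by exact_mod_cast hn
  rw [div_le_iff₀ hc] at hN
  nlinarith

end Sekatskii2015Trend

open Sekatskii2015Trend in
/-- **RH-FREE. The trend law of the archimedean part of Sekatskii's generalized Li derivatives.**
For `b > 0` and `n ≥ 1`, with `H_n` the harmonic number, the archimedean (Gamma-factor) part
`G_b(n) := (1/(n−1)!) dⁿ/dzⁿ[(z+b)^{n−1} ln ξ(z)]|_{z=b+1} − (1/(n−1)!) dⁿ/dzⁿ[(z+b)^{n−1} ln((z−1)ζ(z))]|_{z=b+1}`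
(`= S_b(n)/(2b+1) + (n/2)ψ((b+1)/2) + n/(b+1) − (n/2) ln π` by eq. (7a), `sekatskii2015_eq7a`) satisfies

  `|G_b(n) − ((n/2)(H_n − 1 − ln(2π/(2b+1))) + (1−b)/(2(2b+1)))| ≤ (b/2 + (2b+1)/6 + b²/4 + 2(2b+1)/π)/(2b+1)`.

The source computes `G_b(n)` exactly (eq. (7a), p. 18) and brackets its growth through Lemma 2,
eq. (11) (p. 10) (`(n/2) ln n + O_b(n)` with the linear coefficient pinned to a window); the closed
form with `H_n` and a uniform `O_b(1)` error is the `b = 0` trend law of Voros 2006 §4 (4.6) (tree: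
`abs_keiperLiCoeff_sub_osc_sub_trend_le`, error `2/π`; at `b = 0` the bound here is `1/6 + 2/π`)
transported along `z = −b + (2b+1)s`, proved here by the same generating-function/Cauchy-estimate
method; no hypothesis on the zeros of `ζ` enters.
-- TODO(general form): the error is in fact `c_b + o(1)` (even `o(n^{−N})` after subtracting a
-- polynomial in `1/n`, as in Voros); only the uniform `O_b(1)` is typed.
[cite: Sekatskii2015FirstApplications, eq. (7a) (p. 18) and Lemma 2, eq. (11) (p. 10)] -/
theorem abs_liSekatskiiDeriv_sub_zetaDeriv_sub_trend_le {b : ℝ} (hb : 0 < b) {n : ℕ} (hn : 1 ≤ n) :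
    |liSekatskiiDeriv (-b) (b + 1) n - liSekatskiiZetaDeriv (-b) (b + 1) n -
      ((n : ℝ) / 2 * ((harmonic n : ℝ) - 1 - Real.log (2 * Real.pi / (2 * b + 1))) +
        (1 - b) / (2 * (2 * b + 1)))| ≤
      (b / 2 + (2 * b + 1) / 6 + b ^ 2 / 4 + 2 * (2 * b + 1) / Real.pi) / (2 * b + 1) := by
  obtain ⟨m, rfl⟩ : ∃ m, n = m + 1 := ⟨n - 1, by omega⟩
  rw [gammaPart_eq_re_iteratedDeriv hb m, iteratedDeriv_gen_zero hb m, iteratedDeriv_elem_zero,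
    ← harmonic_cast_eq_sum]
  set Rm := iteratedDeriv m (rem b) 0 with hRm
  have hfpos : (0 : ℝ) < m ! := by exact_mod_cast Nat.factorial_pos m
  have hq : 0 < 2 * b + 1 := by linarith
  set X : ℝ := (2 * b + 1) / 2 * (((m : ℝ) + 1) * (((harmonic (m + 1) : ℚ) : ℝ) - 1 - Real.log 2)) +
    (2 * b + 1) / 2 * (Real.log (2 * b + 1) - Real.log Real.pi) * ((m : ℝ) + 1) + (1 - b) / 2
    with hXdef
  have hX : (2 * (b : ℂ) + 1) / 2 * (((m + 1)! : ℂ) * ((((harmonic (m + 1) : ℚ) : ℝ) : ℂ) - 1 -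
        Real.log 2)) +
      (2 * (b : ℂ) + 1) / 2 * ((Real.log (2 * b + 1) : ℂ) - Real.log Real.pi) * ((m + 1)! : ℂ) +
      (1 - (b : ℂ)) / 2 * (m ! : ℂ) = (((m ! : ℝ) * X : ℝ) : ℂ) := by
    rw [hXdef, Nat.factorial_succ]; push_cast; ring
  rw [hX, add_div, Complex.add_re, ← Complex.ofReal_natCast, ← Complex.ofReal_div, Complex.ofReal_re,
    mul_div_cancel_left₀ _ hfpos.ne']
  have hlog : Real.log (2 * Real.pi / (2 * b + 1)) =
      Real.log 2 + Real.log Real.pi - Real.log (2 * b + 1) := by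
    rw [Real.log_div (by positivity) hq.ne', Real.log_mul two_ne_zero Real.pi_ne_zero]
  have hid : (2 * b + 1)⁻¹ * (X + (Rm / ((m ! : ℝ) : ℂ)).re) -
      (((m + 1 : ℕ) : ℝ) / 2 * (((harmonic (m + 1) : ℚ) : ℝ) - 1 - Real.log (2 * Real.pi / (2 * b + 1))) +
        (1 - b) / (2 * (2 * b + 1))) = (2 * b + 1)⁻¹ * (Rm / ((m ! : ℝ) : ℂ)).re := by
    rw [hlog, hXdef]; push_cast; field_simp; ring
  rw [hid, abs_mul, abs_of_pos (inv_pos.2 hq),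
    show (b / 2 + (2 * b + 1) / 6 + b ^ 2 / 4 + 2 * (2 * b + 1) / Real.pi) / (2 * b + 1) =
      (2 * b + 1)⁻¹ * remBound b by rw [remBound, div_eq_inv_mul]]
  have hR : ‖Rm‖ ≤ m ! * remBound b := norm_iteratedDeriv_rem_le hb.le m
  have hre : |(Rm / ((m ! : ℝ) : ℂ)).re| ≤ ‖Rm‖ / m ! := by
    refine (Complex.abs_re_le_norm _).trans (le_of_eq ?_)
    rw [norm_div, Complex.norm_of_nonneg hfpos.le]
  refine mul_le_mul_of_nonneg_left ?_ (inv_pos.2 hq).le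
  calc |(Rm / ((m ! : ℝ) : ℂ)).re| ≤ ‖Rm‖ / m ! := hre
    _ ≤ m ! * remBound b / m ! := by gcongr
    _ = remBound b := by field_simp

open Sekatskii2015Trend in
/-- **RH-FREE. First-order asymptotic of the archimedean part**: for `b > 0`,
`G_b(n) = (n/2)(ln n − 1 + γ − ln(2π/(2b+1))) + o(n)` (from the trend law and `H_n − ln n → γ`).
This is exactly the main term `liSekatskiiMain (−b) n/(2b+1)` of the source's Theorem 6 for the
whole sum `k_{n,−b}/(2b+1)`: the archimedean part alone produces it, unconditionally.
[cite: Sekatskii2015FirstApplications, eq. (7a) (p. 18), Lemma 2 (p. 10) and eq. (21) (p. 19)] -/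
theorem liSekatskiiDeriv_sub_zetaDeriv_isLittleO {b : ℝ} (hb : 0 < b) :
    (fun n : ℕ ↦ liSekatskiiDeriv (-b) (b + 1) n - liSekatskiiZetaDeriv (-b) (b + 1) n -
        (n : ℝ) / 2 * (Real.log n - 1 + Real.eulerMascheroniConstant -
          Real.log (2 * Real.pi / (2 * b + 1))))
      =o[atTop] (fun n : ℕ ↦ (n : ℝ)) := by
  set M : ℝ := (b / 2 + (2 * b + 1) / 6 + b ^ 2 / 4 + 2 * (2 * b + 1) / Real.pi) / (2 * b + 1)
    with hM
  -- the three pieces: bounded error, `(n/2)(H_n − ln n − γ)`, constant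
  have h1 : (fun n : ℕ ↦ liSekatskiiDeriv (-b) (b + 1) n - liSekatskiiZetaDeriv (-b) (b + 1) n -
      ((n : ℝ) / 2 * ((harmonic n : ℝ) - 1 - Real.log (2 * Real.pi / (2 * b + 1))) +
        (1 - b) / (2 * (2 * b + 1)))) =o[atTop] (fun n : ℕ ↦ (n : ℝ)) := by
    refine IsBigO.trans_isLittleO ?_ isLittleO_one_natCast
    refine IsBigO.of_bound M ?_
    filter_upwards [eventually_ge_atTop 1] with n hn
    rw [Real.norm_eq_abs, norm_one, mul_one]
    exact abs_liSekatskiiDeriv_sub_zetaDeriv_sub_trend_le hb hn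
  have hH : Tendsto (fun n : ℕ ↦ (harmonic n : ℝ) - Real.log n - Real.eulerMascheroniConstant)
      atTop (𝓝 0) := by
    have := Real.tendsto_harmonic_sub_log.sub_const Real.eulerMascheroniConstant
    simpa using this
  have h2 : (fun n : ℕ ↦ (n : ℝ) / 2 * ((harmonic n : ℝ) - Real.log n - Real.eulerMascheroniConstant))
      =o[atTop] (fun n : ℕ ↦ (n : ℝ)) := by
    have hbig : (fun n : ℕ ↦ (n : ℝ) / 2) =O[atTop] (fun n : ℕ ↦ (n : ℝ)) :=
      IsBigO.of_bound (1 / 2) (Eventually.of_forall fun n ↦ by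
        rw [Real.norm_eq_abs, Real.norm_eq_abs, abs_div, abs_two]; linarith [abs_nonneg (n : ℝ)])
    have hsmall := (isLittleO_one_iff ℝ).2 hH
    simpa using hbig.mul_isLittleO hsmall
  have h3 : (fun _ : ℕ ↦ (1 - b) / (2 * (2 * b + 1))) =o[atTop] (fun n : ℕ ↦ (n : ℝ)) := by
    simpa using isLittleO_one_natCast.const_mul_left ((1 - b) / (2 * (2 * b + 1)))
  refine ((h1.add h2).add h3).congr' ?_ EventuallyEq.rfl
  filter_upwards with n
  ring

/-- **RH-FREE. Lemma 2 sharpened to an asymptotic**: for `b > 0`, Sekatskii's trivial-zero sum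
`S_b(n) = Σ_{k≥1}[(1 − (2b+1)/(2k+b+1))ⁿ − 1 + n(2b+1)/(2k+b+1)]` satisfies

  `S_b(n) = ((2b+1)/2)·n ln n + ((2b+1)/2)·(γ − 1 + ln((2b+1)/2) − ψ((b+1)/2) − 2/(b+1))·n + o(n)`.

TYPING NOTE: the printed Lemma 2, eq. (11) (p. 10) only brackets the linear coefficient,
`((2b+1)/2)(γ − 1 + ln(2 − 5/(2b+3))) n + O(1) ≤ S_b(n) − ((2b+1)/2) n ln n ≤ ((2b+1)/2)(γ − 1 +
ln(2 − 1/(b+1))) n + O(1)`; the exact coefficient (which lies in that window, e.g. `b → ∞`: both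
ends `→ ln 2`) is the kernel consequence of eq. (7a) and the trend law above
(`ψ((b+1)/2) + 2/(b+1) = ψ((b+3)/2)`).
[cite: Sekatskii2015FirstApplications, Lemma 2, eq. (11) (p. 10) and eq. (7a) (p. 18)] -/
theorem sekatskii2015_lemma2_isLittleO {b : ℝ} (hb : 0 < b) :
    (fun n : ℕ ↦ liSekatskiiTrivialZeroSum b n - ((2 * b + 1) / 2 * n * Real.log n +
        (2 * b + 1) / 2 * (Real.eulerMascheroniConstant - 1 + Real.log ((2 * b + 1) / 2) -
          (Complex.digamma ((((b + 1) / 2 : ℝ)) : ℂ)).re - 2 / (b + 1)) * n))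
      =o[atTop] (fun n : ℕ ↦ (n : ℝ)) := by
  have hq : 0 < 2 * b + 1 := by linarith
  refine ((liSekatskiiDeriv_sub_zetaDeriv_isLittleO hb).const_mul_left (2 * b + 1)).congr' ?_
    EventuallyEq.rfl
  filter_upwards [eventually_ge_atTop 1] with n hn1
  have h7a := sekatskii2015_eq7a hb hn1
  have hlog : Real.log (2 * Real.pi / (2 * b + 1)) =
      Real.log 2 + Real.log Real.pi - Real.log (2 * b + 1) := by
    rw [Real.log_div (by positivity) hq.ne', Real.log_mul two_ne_zero Real.pi_ne_zero]
  have hlog2 : Real.log ((2 * b + 1) / 2) = Real.log (2 * b + 1) - Real.log 2 :=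
    Real.log_div hq.ne' two_ne_zero
  rw [h7a, hlog, hlog2]
  have hb1 : (b : ℝ) + 1 ≠ 0 := by linarith
  field_simp
  ring

/-- **RH-CONDITIONAL. Exact compensation** (S. K. Sekatskii, arXiv:1404.7276v2, p. 19, after
eq. (21): "We suspect, but cannot prove, that an exact compensation indeed occurs and
`(1/(n−1)!) dⁿ/dzⁿ[(z+b)^{n−1} ln((z−1)ζ(z))]|_{z=b+1} = o(n)` for all `b > 0`" — there left open
because Lemma 2 only brackets the linear term of `S_b(n)`).  PROVED here: on RH, for every `b > 0`,
the ζ-part `liSekatskiiZetaDeriv (−b) (b+1) n` is `o(n)`: the archimedean part carries the full main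
term `liSekatskiiMain (−b) n/(2b+1)` unconditionally (`liSekatskiiDeriv_sub_zetaDeriv_isLittleO`),
and on RH the whole derivative is `k_{n,−b}/(2b+1) = liSekatskiiMain (−b) n/(2b+1) + o(n)` (the
source's Theorem 6 = tree `sekatskii2014b_thm4`).  RH enters only through Theorem 6.
[cite: Sekatskii2015FirstApplications, eq. (21) and the remark following it (p. 19); Theorem 6 (Appendix)] -/
theorem sekatskii2015_exactCompensation (hRH : RiemannHypothesis) {b : ℝ} (hb : 0 < b) :
    (fun n : ℕ ↦ liSekatskiiZetaDeriv (-b) (b + 1) n) =o[atTop] (fun n : ℕ ↦ (n : ℝ)) := by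
  have hq : 0 < 2 * b + 1 := by linarith
  have h1 : (fun n : ℕ ↦ (2 * b + 1)⁻¹ * (liSekatskiiSum (-b) n - liSekatskiiMain (-b) n)) =o[atTop]
      (fun n : ℕ ↦ (n : ℝ)) := (sekatskii2014b_thm4 hRH (-b)).const_mul_left _
  have h2 := liSekatskiiDeriv_sub_zetaDeriv_isLittleO hb
  refine (h1.sub h2).congr' ?_ EventuallyEq.rfl
  filter_upwards [eventually_ge_atTop 1] with n hn1
  have hk := liSekatskiiSum_neg_eq_deriv b hn1
  have habs : |1 - 2 * (-b)| = 2 * b + 1 := by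
    rw [show (1 : ℝ) - 2 * (-b) = 2 * b + 1 by ring]; exact abs_of_pos hq
  rw [liSekatskiiMain, habs, hk]
  field_simp
  ring

/-- **RH-EQUIVALENT packaging** of Proposition 1 with the exact compensation: for any fixed `b > 0`,
`RH ⟺ (1/(n−1)!) dⁿ/dzⁿ[(z+b)^{n−1} ln((z−1)ζ(z))]|_{z=b+1} = o(n)`
(`⟹`: `sekatskii2015_exactCompensation`; `⟸`: `o(n)` gives the one-sided bound of Proposition 1
with `ε = ½`, `sekatskii2015_prop1`).
[cite: Sekatskii2015FirstApplications, Proposition 1 (p. 18) and the remark after eq. (21) (p. 19)] -/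
theorem riemannHypothesis_iff_zetaPart_isLittleO {b : ℝ} (hb : 0 < b) :
    RiemannHypothesis ↔
      (fun n : ℕ ↦ liSekatskiiZetaDeriv (-b) (b + 1) n) =o[atTop] (fun n : ℕ ↦ (n : ℝ)) := by
  refine ⟨fun h ↦ sekatskii2015_exactCompensation h hb, fun h ↦ ?_⟩
  refine sekatskii2015_prop1 hb (ε := 1 / 2) (by norm_num) ?_
  filter_upwards [h.def (by norm_num : (0 : ℝ) < 1 / 4), eventually_ge_atTop 3] with n hn hn3
  rw [Real.norm_eq_abs, Real.norm_natCast] at hn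
  have h3 : (3 : ℝ) ≤ n := by exact_mod_cast hn3
  have hlog : 1 ≤ Real.log n := by
    rw [← Real.log_exp 1]
    exact Real.log_le_log (Real.exp_pos 1) (by linarith [Real.exp_one_lt_d9])
  have h0 : (0 : ℝ) ≤ n := Nat.cast_nonneg n
  have := (abs_le.1 hn).1
  nlinarith

end Literature.NumberTheory.LFunctions
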